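import Summits.MatrixMultiplication.MatrixMultiplication.Theorems.SaturationLadderSpectralFloorLegs
import Literature.Computability.AlgebraicComplexity.RectangularExponentAsymptoticRank
import Literature.Computability.AlgebraicComplexity.RectangularExponentSymmetry
import Literature.Computability.AlgebraicComplexity.RectangularExponentInformationBound
import Literature.Computability.AlgebraicComplexity.RectangularExponentSubadditivity
import HarnessLib

/-!
# Route `SaturationLadder` — flat formats: the floor as a base-free threshold; matrix multiplication
formats as base tensors (decomp-mm lens 1 «grading / quantitative ladder», gen 26; route-free helper, NO `Theses` import)

Gen 25 (`SaturationLadderSpectralFloor`, `…Legs`) proved the gauge FLOOR of a certificate `T^{⊗N} ⊵ ⟨t⟩ ⊗ ⟨q^a,q^b,q^c⟩`,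
`(a+c)·log R̃(T)/log ζ⁽¹⁾(T) ≤ U := (N log R̃(T) − log t)/log q`, and «an `ε`-exact FAMILY from powers of ONE base forces
`R̃(T) = ζ⁽¹⁾(T)`».  Here the floor is made BASE-FREE and read on the one family of bases whose flatness ratio is an exponent.
* §1 per certificate, any base: **`R̃(T)^{a+c} ≤ ζ⁽¹⁾(T)^U`** (`asymptoticRank_pow_le`); `φ₁(T) := log R̃/log ζ⁽¹⁾ ≤ U/(a+c)`;
  `(a+c)·κ₁(T) ≤ U − (a+c)` (critic g10 r1: a base-free family with defects `U_m − (a_m+c_m) → 0` has `κ₁(T_m)(a_m+c_m) → 0`);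
  an `ε`-exact certificate has an `ε`-flat base `R̃(T) ≤ ζ⁽¹⁾(T)^{1+ε}`, an exact one a flat base (`flat_of_exact`); the
  exactness theorem with any admissible `r ≥ R̃(T)` (`certifiedExponent_mono`, `asymptoticRank_eq_flatteningRank_of_exact_le`; r2).
* §2 MATRIX MULTIPLICATION FORMATS as bases (`p ≥ 2`): `ζ⁽¹⁾(⟨p^a,p^b,p^c⟩) = p^{a+c}`, `R̃ = p^{ω(a,b,c)}` (tree, ADVXXZ §3.4),
  so **`φ₁(⟨p^a,p^b,p^c⟩) = ω(a,b,c)/(a+c)`**, the RELATIVE THICKNESS of the format, and `⟨p^a,p^b,p^c⟩` is flat iff the format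
  is TIGHT, `ω(a,b,c) = a+c` (`matMul_rect_flat_iff_tight`); tight formats add (`tight_add`).
* §3 the floor between formats: a power of `⟨p^{a'},p^{b'},p^{c'}⟩` certifies `ω(a,b,c) ≤ U` only with
  **`U ≥ (a+c)·ω(a',b',c')/(a'+c')`** — certification never lowers relative thickness below the base's; an exact (`ε`-exact)
  certificate needs a tight (`ε`-tight) base format; cube base `U ≥ (a+c)·ω/2`, far base `⟨p^k,p,p⟩`: `U ≥ (a+c)·ω(1,k,1)/(k+1)`.
* Chain file 2 (`SaturationLadderFlatFormatsItems`) reads the route's items in this currency by name (`E_k ⟺ ⟨p^k,p,p⟩ flat`,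
  `TailDescentTwo`/`SquareFromTwo`/summit = flat-to-flat transfers `⟨p^k,p,p⟩ → ⟨p²,p,p⟩ → ⟨p,p,p⟩`, thin points of
  `SubexpSaturation` ⟺ thin formats flat) and lists the tree's unconditionally flat formats; the floor prices the crux side
  (exact thin points come from flat bases only) and is silent on the residual side (flat bases by hypothesis).
Placement as gen 25: vertex case of the catalogued `RectangularBarrier` (CLLZ 2020 Thm. 3.10 / eq. (5)), flattening member of
the `UniversalMethodBarrier` family, hypothesis-free, used as a resource.  Support module beneath stmt-MatrixMultiplication-25909;
closes no item; 0 sorry; no definitions; imports only BUILT modules.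
[cite: ChristandlLeGallLysikovZuiddam2020, Thm. 3.10 and eq. (5); ChristandlVranaZuiddam2023, Example 1.4 and Prop. 1.6;
AlmanDuanVassilevskaWilliamsXuXuZhou2025, §3.4 and Thm. 3.2; LottiRomani1983, §1; Strassen1988, §3]
-/

set_option linter.dupNamespace false

noncomputable section

open scoped BigOperators

namespace Summit.MatrixMultiplication.MatrixMultiplication.Theorems.SaturationLadderFlatFormats

open Literature.Computability.AlgebraicComplexity
open Literature.Barriers.MatrixMultiplication
open Summit.MatrixMultiplication.MatrixMultiplication.Theorems.SaturationLadderSpectralFloor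
  (gauge₁_floor gauge₁_floor_asymptoticRank asymptoticRank_eq_flatteningRank_of_exact)  -- landed, imported
open Summit.MatrixMultiplication.MatrixMultiplication.Theorems.SaturationLadderSpectralFloorLegs
  (flatteningRank_matMulTensor_cube matMul_flat_iff_omega_two)  -- landed, imported

variable {K : Type} [Field K]
variable {ι κ μ : Type} [Fintype ι] [Fintype κ] [Fintype μ]

/-! ## 1. The floor as a base-free threshold -/

section Threshold

/-- **Log form of the floor**: for every certificate `T^{⊗N} ⊵ ⟨t⟩ ⊗ ⟨q^a,q^b,q^c⟩` (`q ≥ 2`, `t ≥ 1`,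
`ζ⁽¹⁾(T) > 1`) with certified exponent `U = (N log R̃(T) − log t)/log q`:
`(a + c) · log R̃(T) ≤ U · log ζ⁽¹⁾(T)`. [cite: ChristandlLeGallLysikovZuiddam2020, Thm. 3.10 and eq. (5)] -/
theorem length_mul_log_asymptoticRank_le (T : ι → κ → μ → K) {N t q a b c : ℕ} (hq : 2 ≤ q) (ht : 1 ≤ t)
    (h : PolyDegeneratesTo (kroneckerPow T N)
      (kroneckerTensor (unitTensor K t) (matMulTensor K (q ^ a) (q ^ b) (q ^ c))))
    (hT : 1 < flatteningRank T) :
    ((a + c : ℕ) : ℝ) * Real.log (asymptoticRank T) ≤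
      ((N : ℝ) * Real.log (asymptoticRank T) - Real.log t) / Real.log q *
        Real.log (flatteningRank T : ℝ) := by
  have hfl := gauge₁_floor_asymptoticRank T hq ht h hT
  have hζ1 : (1 : ℝ) < (flatteningRank T : ℝ) := by exact_mod_cast hT
  have hL : 0 < Real.log (flatteningRank T : ℝ) := Real.log_pos hζ1
  have h2 := mul_le_mul_of_nonneg_right hfl hL.le
  rwa [mul_assoc, div_mul_cancel₀ _ hL.ne'] at h2

/-- **Power form — the base-free floor: `R̃(T)^{a+c} ≤ ζ⁽¹⁾(T)^U`.**  The asymptotic rank of the base to the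
binding length of the target is at most its flattening rank to the certified exponent; for a flat base
(`R̃ = ζ⁽¹⁾`) this is only `a + c ≤ U`, the flattening lower bound. [cite: ChristandlLeGallLysikovZuiddam2020, Thm. 3.10; ChristandlVranaZuiddam2023, Example 1.4] -/
theorem asymptoticRank_pow_le (T : ι → κ → μ → K) {N t q a b c : ℕ} (hq : 2 ≤ q) (ht : 1 ≤ t)
    (h : PolyDegeneratesTo (kroneckerPow T N)
      (kroneckerTensor (unitTensor K t) (matMulTensor K (q ^ a) (q ^ b) (q ^ c))))
    (hT : 1 < flatteningRank T) :
    asymptoticRank T ^ (a + c) ≤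
      (flatteningRank T : ℝ) ^ (((N : ℝ) * Real.log (asymptoticRank T) - Real.log t) / Real.log q) := by
  have hlog := length_mul_log_asymptoticRank_le T hq ht h hT
  have hζ1 : (1 : ℝ) < (flatteningRank T : ℝ) := by exact_mod_cast hT
  have hζ0 : (0 : ℝ) < (flatteningRank T : ℝ) := by linarith
  have hR0 : 0 < asymptoticRank T := hζ0.trans_le (flatteningRank_le_asymptoticRank T)
  rw [← Real.log_le_log_iff (pow_pos hR0 _) (Real.rpow_pos_of_pos hζ0 _), Real.log_pow,
    Real.log_rpow hζ0]
  exact_mod_cast hlog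

/-- **Ratio form**: the FLATNESS RATIO `φ₁(T) := log R̃(T)/log ζ⁽¹⁾(T)` (`≥ 1`) of the base is at most the
certified relative excess `U/(a+c)` (`a + c ≥ 1`). [cite: ChristandlLeGallLysikovZuiddam2020, Thm. 3.10 and eq. (5)] -/
theorem flatRatio_le (T : ι → κ → μ → K) {N t q a b c : ℕ} (hq : 2 ≤ q) (ht : 1 ≤ t)
    (h : PolyDegeneratesTo (kroneckerPow T N)
      (kroneckerTensor (unitTensor K t) (matMulTensor K (q ^ a) (q ^ b) (q ^ c))))
    (hT : 1 < flatteningRank T) (hac : 1 ≤ a + c) :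
    Real.log (asymptoticRank T) / Real.log (flatteningRank T : ℝ) ≤
      ((N : ℝ) * Real.log (asymptoticRank T) - Real.log t) / Real.log q / ((a + c : ℕ) : ℝ) := by
  have hfl := gauge₁_floor_asymptoticRank T hq ht h hT
  have hac0 : (0 : ℝ) < ((a + c : ℕ) : ℝ) := by exact_mod_cast (by omega : 0 < a + c)
  rw [le_div_iff₀ hac0, mul_comm]
  exact hfl

/-- **Absolute-defect form** (critic g10 r1): `(a+c) · κ₁(T) ≤ U − (a+c)`, `κ₁(T) = log R̃(T)/log ζ⁽¹⁾(T) − 1 ≥ 0`.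
Along any BASE-FREE family of certificates `(T_m; N_m, t_m, q_m, a_m, b_m, c_m)` whose absolute defects
`U_m − (a_m + c_m)` tend to `0`, `κ₁(T_m)·(a_m + c_m) → 0`: long exact targets need proportionally flatter bases.
[cite: ChristandlLeGallLysikovZuiddam2020, Thm. 3.10 and eq. (5)] -/
theorem length_mul_kappa_le_defect (T : ι → κ → μ → K) {N t q a b c : ℕ} (hq : 2 ≤ q) (ht : 1 ≤ t)
    (h : PolyDegeneratesTo (kroneckerPow T N)
      (kroneckerTensor (unitTensor K t) (matMulTensor K (q ^ a) (q ^ b) (q ^ c))))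
    (hT : 1 < flatteningRank T) :
    ((a + c : ℕ) : ℝ) * (Real.log (asymptoticRank T) / Real.log (flatteningRank T : ℝ) - 1) ≤
      ((N : ℝ) * Real.log (asymptoticRank T) - Real.log t) / Real.log q - ((a + c : ℕ) : ℝ) := by
  have hfl := gauge₁_floor_asymptoticRank T hq ht h hT
  rw [mul_sub, mul_one]
  linarith

/-- **An `ε`-exact certificate has an `ε`-flat base**: `U ≤ (1+ε)(a+c)` (`a + c ≥ 1`) ⟹
`R̃(T) ≤ ζ⁽¹⁾(T)^{1+ε}`.  Per certificate, no family, any base. [cite: ChristandlLeGallLysikovZuiddam2020, Thm. 3.10; ChristandlVranaZuiddam2023, Prop. 1.6] -/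
theorem asymptoticRank_le_rpow_of_nearExact (T : ι → κ → μ → K) {N t q a b c : ℕ} (hq : 2 ≤ q)
    (ht : 1 ≤ t)
    (h : PolyDegeneratesTo (kroneckerPow T N)
      (kroneckerTensor (unitTensor K t) (matMulTensor K (q ^ a) (q ^ b) (q ^ c))))
    (hT : 1 < flatteningRank T) (hac : 1 ≤ a + c) {ε : ℝ}
    (hU : ((N : ℝ) * Real.log (asymptoticRank T) - Real.log t) / Real.log q ≤
      (1 + ε) * ((a + c : ℕ) : ℝ)) :
    asymptoticRank T ≤ (flatteningRank T : ℝ) ^ (1 + ε) := by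
  have hζ1 : (1 : ℝ) < (flatteningRank T : ℝ) := by exact_mod_cast hT
  have hζ0 : (0 : ℝ) < (flatteningRank T : ℝ) := by linarith
  have hL : 0 < Real.log (flatteningRank T : ℝ) := Real.log_pos hζ1
  have hR0 : 0 < asymptoticRank T := hζ0.trans_le (flatteningRank_le_asymptoticRank T)
  have hac0 : (0 : ℝ) < ((a + c : ℕ) : ℝ) := by exact_mod_cast (by omega : 0 < a + c)
  have h1 : Real.log (asymptoticRank T) / Real.log (flatteningRank T : ℝ) ≤ 1 + ε := by
    refine (flatRatio_le T hq ht h hT hac).trans ?_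
    rw [div_le_iff₀ hac0]
    exact hU
  rw [div_le_iff₀ hL] at h1
  rw [← Real.log_le_log_iff hR0 (Real.rpow_pos_of_pos hζ0 _), Real.log_rpow hζ0]
  exact h1

/-- **An exact certificate has a flat base**: `U ≤ a + c` (`a + c ≥ 1`) ⟹ `R̃(T) = ζ⁽¹⁾(T)` — the single-
certificate case of gen 25's «exactness forces flatness», valid for ANY base tensor: exactly tight points
(`ω(a,b,c) = a + c`, the currency of `SubexpSaturation`) are certified by powers of flat tensors or by none.
[cite: ChristandlLeGallLysikovZuiddam2020, Thm. 3.10; ChristandlVranaZuiddam2023, Example 1.4 and Prop. 1.6] -/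
theorem flat_of_exact (T : ι → κ → μ → K) {N t q a b c : ℕ} (hq : 2 ≤ q) (ht : 1 ≤ t)
    (h : PolyDegeneratesTo (kroneckerPow T N)
      (kroneckerTensor (unitTensor K t) (matMulTensor K (q ^ a) (q ^ b) (q ^ c))))
    (hT : 1 < flatteningRank T) (hac : 1 ≤ a + c)
    (hU : ((N : ℝ) * Real.log (asymptoticRank T) - Real.log t) / Real.log q ≤ ((a + c : ℕ) : ℝ)) :
    asymptoticRank T = flatteningRank T := by
  have h1 := asymptoticRank_le_rpow_of_nearExact T hq ht h hT hac (ε := 0)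
    (by rw [add_zero, one_mul]; exact hU)
  rw [add_zero, Real.rpow_one] at h1
  exact le_antisymm h1 (flatteningRank_le_asymptoticRank T)

/-- **The certified exponent is monotone in the admissible rank bound** (critic g10 r2): for
`0 < R ≤ r` (e.g. `R = R̃(T) ≤ r`), `(N log R − log t)/log q ≤ (N log r − log t)/log q`; so every floor /
exactness statement with `r = R̃(T)` covers every certificate read with any admissible `r ≥ R̃(T)`. [folklore] -/
theorem certifiedExponent_mono {R r : ℝ} (hR : 0 < R) (hRr : R ≤ r) (N t : ℕ) {q : ℕ} (hq : 2 ≤ q) :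
    ((N : ℝ) * Real.log R - Real.log t) / Real.log q ≤ ((N : ℝ) * Real.log r - Real.log t) / Real.log q := by
  have hq1 : (1 : ℝ) < q := by exact_mod_cast (by omega : 1 < q)
  have hlogq : 0 < Real.log q := Real.log_pos hq1
  have hlog := Real.log_le_log hR hRr
  have hN : (0 : ℝ) ≤ N := Nat.cast_nonneg N
  exact div_le_div_of_nonneg_right (by nlinarith) hlogq.le

/-- **Exactness forces flatness, with any admissible rank bounds** (`exact_of_exact_le`, critic g10 r2): if for
every `ε > 0` some power of `T` certifies some `⟨t⟩ ⊗ ⟨q^a,q^b,q^c⟩` with SOME admissible `r ≥ R̃(T)` and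
`(N log r − log t)/log q ≤ (1+ε)(a+c)`, then `R̃(T) = ζ⁽¹⁾(T)`. [cite: ChristandlLeGallLysikovZuiddam2020, Thm. 3.10; ChristandlVranaZuiddam2023, Prop. 1.6] -/
theorem asymptoticRank_eq_flatteningRank_of_exact_le (T : ι → κ → μ → K) (hT : 1 < flatteningRank T)
    (h : ∀ ε : ℝ, 0 < ε → ∃ N t q a b c : ℕ, ∃ r : ℝ, 1 ≤ t ∧ 2 ≤ q ∧ 1 ≤ a + c ∧
      asymptoticRank T ≤ r ∧
      PolyDegeneratesTo (kroneckerPow T N)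
        (kroneckerTensor (unitTensor K t) (matMulTensor K (q ^ a) (q ^ b) (q ^ c))) ∧
      ((N : ℝ) * Real.log r - Real.log t) / Real.log q ≤ (1 + ε) * ((a + c : ℕ) : ℝ)) :
    asymptoticRank T = flatteningRank T := by
  have hζ1 : (1 : ℝ) < (flatteningRank T : ℝ) := by exact_mod_cast hT
  have hζ0 : (0 : ℝ) < (flatteningRank T : ℝ) := by linarith
  have hR0 : 0 < asymptoticRank T := hζ0.trans_le (flatteningRank_le_asymptoticRank T)
  refine asymptoticRank_eq_flatteningRank_of_exact T hT fun ε hε => ?_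
  obtain ⟨N, t, q, a, b, c, r, ht, hq, hac, hr, hdeg, hU⟩ := h ε hε
  exact ⟨N, t, q, a, b, c, ht, hq, hac, hdeg, (certifiedExponent_mono hR0 hr N t hq).trans hU⟩

end Threshold

/-! ## 2. Matrix multiplication formats as base tensors: `φ₁(⟨p^a,p^b,p^c⟩) = ω(a,b,c)/(a+c)` -/

section Formats

/-- `ζ⁽¹⁾(⟨p^a,p^b,p^c⟩) = p^{a+c}` (`p ≥ 1`; the output-leg flattening, tree `gaugePoint₁_matMulTensor`).
[cite: ChristandlVranaZuiddam2023, Example 1.4] -/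
theorem flatteningRank_matMulTensor_rect {p : ℕ} (hp : 1 ≤ p) (a b c : ℕ) :
    (flatteningRank (matMulTensor K (p ^ a) (p ^ b) (p ^ c)) : ℝ) = (p : ℝ) ^ (a + c) := by
  rw [← gaugePoint₁_eq, gaugePoint₁_matMulTensor (pow_pos (by omega) b)]
  push_cast
  ring

/-- `1 < ζ⁽¹⁾(⟨p^a,p^b,p^c⟩)` for `p ≥ 2`, `a + c ≥ 1`. [folklore] -/
theorem one_lt_flatteningRank_matMulTensor_rect {p : ℕ} (hp : 2 ≤ p) {a c : ℕ} (b : ℕ)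
    (hac : 1 ≤ a + c) : 1 < flatteningRank (matMulTensor K (p ^ a) (p ^ b) (p ^ c)) := by
  have h : (1 : ℝ) < (flatteningRank (matMulTensor K (p ^ a) (p ^ b) (p ^ c)) : ℝ) := by
    rw [flatteningRank_matMulTensor_rect (by omega) a b c]
    have hp1 : (1 : ℝ) < p := by exact_mod_cast (by omega : 1 < p)
    exact one_lt_pow₀ hp1 (by omega)
  exact_mod_cast h

/-- `log R̃(⟨p^a,p^b,p^c⟩) = ω(a,b,c) · log p` (`p ≥ 2`; tree `asymptoticRank_matMulTensor_rect`, ADVXXZ §3.4).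
[cite: AlmanDuanVassilevskaWilliamsXuXuZhou2025, §3.4] -/
theorem log_asymptoticRank_matMulTensor_rect {p : ℕ} (hp : 2 ≤ p) (a b c : ℕ) :
    Real.log (asymptoticRank (matMulTensor K (p ^ a) (p ^ b) (p ^ c))) =
      omegaRect K a b c * Real.log p := by
  have hp0 : (0 : ℝ) < p := by exact_mod_cast (by omega : 0 < p)
  rw [asymptoticRank_matMulTensor_rect K hp a b c, Real.log_rpow hp0]

/-- `log ζ⁽¹⁾(⟨p^a,p^b,p^c⟩) = (a + c) · log p`. [cite: ChristandlVranaZuiddam2023, Example 1.4] -/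
theorem log_flatteningRank_matMulTensor_rect {p : ℕ} (hp : 2 ≤ p) (a b c : ℕ) :
    Real.log (flatteningRank (matMulTensor K (p ^ a) (p ^ b) (p ^ c)) : ℝ) =
      ((a + c : ℕ) : ℝ) * Real.log p := by
  rw [flatteningRank_matMulTensor_rect (by omega) a b c, Real.log_pow]

/-- **`φ₁(⟨p^a,p^b,p^c⟩) = ω(a,b,c)/(a+c)`**: on matrix multiplication formats the flatness ratio of the floor IS
the relative thickness of the format (`p ≥ 2`; independent of `p`; both sides read `0` if `a + c = 0`). [cite: AlmanDuanVassilevskaWilliamsXuXuZhou2025, §3.4; ChristandlVranaZuiddam2023, Example 1.4] -/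
theorem flatRatio_matMulTensor_rect {p : ℕ} (hp : 2 ≤ p) (a b c : ℕ) :
    Real.log (asymptoticRank (matMulTensor K (p ^ a) (p ^ b) (p ^ c))) /
        Real.log (flatteningRank (matMulTensor K (p ^ a) (p ^ b) (p ^ c)) : ℝ) =
      omegaRect K a b c / ((a + c : ℕ) : ℝ) := by
  have hp1 : (1 : ℝ) < p := by exact_mod_cast (by omega : 1 < p)
  have hL : 0 < Real.log p := Real.log_pos hp1
  rw [log_asymptoticRank_matMulTensor_rect hp, log_flatteningRank_matMulTensor_rect hp,
    mul_div_mul_right _ _ hL.ne']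

/-- **`⟨p^a,p^b,p^c⟩` is flat iff the format is tight**: `R̃ = ζ⁽¹⁾ ⟺ ω(a,b,c) = a + c` (`p ≥ 2`).  Strassen's
asymptotic rank conjecture restricted to the matrix multiplication formats binding on the output leg is the
statement that every such format is tight. [cite: AlmanDuanVassilevskaWilliamsXuXuZhou2025, §3.4; ChristandlVranaZuiddam2023, Example 1.4; Strassen1988, §3] -/
theorem matMul_rect_flat_iff_tight {p : ℕ} (hp : 2 ≤ p) (a b c : ℕ) :
    asymptoticRank (matMulTensor K (p ^ a) (p ^ b) (p ^ c)) =
        flatteningRank (matMulTensor K (p ^ a) (p ^ b) (p ^ c)) ↔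
      omegaRect K a b c = ((a + c : ℕ) : ℝ) := by
  rw [asymptoticRank_matMulTensor_rect K hp a b c, flatteningRank_matMulTensor_rect (by omega) a b c]
  have hp1 : (1 : ℝ) < p := by exact_mod_cast (by omega : 1 < p)
  have hp0 : (0 : ℝ) < p := by linarith
  constructor
  · intro h
    have h' := congrArg Real.log h
    rw [Real.log_rpow hp0, Real.log_pow] at h'
    exact mul_right_cancel₀ (Real.log_pos hp1).ne' h'
  · intro h
    rw [h, Real.rpow_natCast]

/-- **Tight formats add** (`ω` subadditive, Lotti–Romani; the flattening bound additive): the Kronecker product of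
flat matrix multiplication formats is flat. [cite: LottiRomani1983, §1 (p. 173)] -/
theorem tight_add {a b c a' b' c' : ℕ} (h : omegaRect K a b c = ((a + c : ℕ) : ℝ))
    (h' : omegaRect K a' b' c' = ((a' + c' : ℕ) : ℝ)) :
    omegaRect K ((a + a' : ℕ) : ℝ) ((b + b' : ℕ) : ℝ) ((c + c' : ℕ) : ℝ) =
      ((a + a' + (c + c') : ℕ) : ℝ) := by
  have hsub := LottiRomani1983_subadditive K (a : ℝ) b c a' b' c'
  have hlow := add_le_omegaRect₁₃ K ((a + a' : ℕ) : ℝ) ((b + b' : ℕ) : ℝ) ((c + c' : ℕ) : ℝ)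
  push_cast at hsub hlow h h' ⊢
  linarith

end Formats

/-! ## 3. The floor between matrix multiplication formats -/

section BaseFloor

/-- **Floor with a matrix multiplication format as base.**  If a power of `⟨p^{a'},p^{b'},p^{c'}⟩` (`p ≥ 2`,
`a' + c' ≥ 1`) certifies `⟨t⟩ ⊗ ⟨q^a,q^b,q^c⟩`, the certified exponent `U = (N ω(a',b',c') log p − log t)/log q`
obeys **`(a+c) · ω(a',b',c')/(a'+c') ≤ U`**: certification never lowers the relative thickness below the base's.
[cite: ChristandlLeGallLysikovZuiddam2020, Thm. 3.10 and eq. (5); AlmanDuanVassilevskaWilliamsXuXuZhou2025, §3.4] -/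
theorem matMulBase_floor {p : ℕ} (hp : 2 ≤ p) {a' c' : ℕ} (b' : ℕ) (hac' : 1 ≤ a' + c')
    {N t q a b c : ℕ} (hq : 2 ≤ q) (ht : 1 ≤ t)
    (h : PolyDegeneratesTo (kroneckerPow (matMulTensor K (p ^ a') (p ^ b') (p ^ c')) N)
      (kroneckerTensor (unitTensor K t) (matMulTensor K (q ^ a) (q ^ b) (q ^ c)))) :
    ((a + c : ℕ) : ℝ) * (omegaRect K a' b' c' / ((a' + c' : ℕ) : ℝ)) ≤
      ((N : ℝ) * (omegaRect K a' b' c' * Real.log p) - Real.log t) / Real.log q := by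
  have hT := one_lt_flatteningRank_matMulTensor_rect (K := K) hp b' hac'
  have hfl := gauge₁_floor_asymptoticRank _ hq ht h hT
  rwa [flatRatio_matMulTensor_rect hp a' b' c', log_asymptoticRank_matMulTensor_rect hp] at hfl

/-- **Exact certification needs a tight base format**: if a power of `⟨p^{a'},p^{b'},p^{c'}⟩` certifies the
target EXACTLY, `U ≤ a + c` (`a + c ≥ 1`), then `ω(a',b',c') = a' + c'`.  Exactly tight points propagate only from
exactly tight formats. [cite: ChristandlLeGallLysikovZuiddam2020, Thm. 3.10; LottiRomani1983, §1 (p. 173)] -/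
theorem base_tight_of_exact {p : ℕ} (hp : 2 ≤ p) {a' c' : ℕ} (b' : ℕ) (hac' : 1 ≤ a' + c')
    {N t q a b c : ℕ} (hq : 2 ≤ q) (ht : 1 ≤ t)
    (h : PolyDegeneratesTo (kroneckerPow (matMulTensor K (p ^ a') (p ^ b') (p ^ c')) N)
      (kroneckerTensor (unitTensor K t) (matMulTensor K (q ^ a) (q ^ b) (q ^ c))))
    (hac : 1 ≤ a + c)
    (hU : ((N : ℝ) * (omegaRect K a' b' c' * Real.log p) - Real.log t) / Real.log q ≤
      ((a + c : ℕ) : ℝ)) :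
    omegaRect K a' b' c' = ((a' + c' : ℕ) : ℝ) := by
  have hfl := (matMulBase_floor hp b' hac' hq ht h).trans hU
  have hac0 : (0 : ℝ) < ((a + c : ℕ) : ℝ) := by exact_mod_cast (by omega : 0 < a + c)
  have hac0' : (0 : ℝ) < ((a' + c' : ℕ) : ℝ) := by exact_mod_cast (by omega : 0 < a' + c')
  have h1 : omegaRect K a' b' c' / ((a' + c' : ℕ) : ℝ) ≤ 1 := by
    refine le_of_mul_le_mul_left ?_ hac0
    rw [mul_one]
    exact hfl
  rw [div_le_one hac0'] at h1
  have hlow := add_le_omegaRect₁₃ K (a' : ℝ) b' c'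
  push_cast at h1 hlow ⊢
  linarith

/-- **`ε`-exact certification needs an `ε`-tight base format**: `U ≤ (1+ε)(a+c)` ⟹
`ω(a',b',c') ≤ (1+ε)(a'+c')`. [cite: ChristandlLeGallLysikovZuiddam2020, Thm. 3.10; LottiRomani1983, §1 (p. 173)] -/
theorem base_nearTight_of_nearExact {p : ℕ} (hp : 2 ≤ p) {a' c' : ℕ} (b' : ℕ) (hac' : 1 ≤ a' + c')
    {N t q a b c : ℕ} (hq : 2 ≤ q) (ht : 1 ≤ t)
    (h : PolyDegeneratesTo (kroneckerPow (matMulTensor K (p ^ a') (p ^ b') (p ^ c')) N)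
      (kroneckerTensor (unitTensor K t) (matMulTensor K (q ^ a) (q ^ b) (q ^ c))))
    (hac : 1 ≤ a + c) {ε : ℝ}
    (hU : ((N : ℝ) * (omegaRect K a' b' c' * Real.log p) - Real.log t) / Real.log q ≤
      (1 + ε) * ((a + c : ℕ) : ℝ)) :
    omegaRect K a' b' c' ≤ (1 + ε) * ((a' + c' : ℕ) : ℝ) := by
  have hfl := (matMulBase_floor hp b' hac' hq ht h).trans hU
  have hac0 : (0 : ℝ) < ((a + c : ℕ) : ℝ) := by exact_mod_cast (by omega : 0 < a + c)
  have hac0' : (0 : ℝ) < ((a' + c' : ℕ) : ℝ) := by exact_mod_cast (by omega : 0 < a' + c')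
  have h1 : omegaRect K a' b' c' / ((a' + c' : ℕ) : ℝ) ≤ 1 + ε := by
    refine le_of_mul_le_mul_left ?_ hac0
    rw [mul_comm ((a + c : ℕ) : ℝ) (1 + ε)]
    exact hfl
  rwa [div_le_iff₀ hac0'] at h1

/-- **Cube base**: every certificate from a power of a square matrix multiplication tensor `⟨p,p,p⟩` (`p ≥ 2`)
obeys `(a+c) · ω/2 ≤ U = (N ω log p − log t)/log q` (`φ₁(⟨p,p,p⟩) = ω/2`): e.g. from Strassen's `⟨2,2,2⟩` no thin
exponent below `(1+r)·ω/2` is certifiable, and exact thin points from a fixed square algorithm need `ω = 2` (gen 25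
`omega_eq_two_of_exact_matMul_family`). [cite: ChristandlLeGallLysikovZuiddam2020, Thm. 3.10; ChristandlVranaZuiddam2023, Example 1.4] -/
theorem cubeBase_floor {p : ℕ} (hp : 2 ≤ p) {N t q a b c : ℕ} (hq : 2 ≤ q) (ht : 1 ≤ t)
    (h : PolyDegeneratesTo (kroneckerPow (matMulTensor K p p p) N)
      (kroneckerTensor (unitTensor K t) (matMulTensor K (q ^ a) (q ^ b) (q ^ c)))) :
    ((a + c : ℕ) : ℝ) * (omega K / 2) ≤
      ((N : ℝ) * (omega K * Real.log p) - Real.log t) / Real.log q := by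
  have hp1 : (1 : ℝ) < p := by exact_mod_cast (by omega : 1 < p)
  have hp0 : (0 : ℝ) < p := by linarith
  have hL : 0 < Real.log p := Real.log_pos hp1
  have hζ : (flatteningRank (matMulTensor K p p p) : ℝ) = (p : ℝ) ^ 2 :=
    flatteningRank_matMulTensor_cube (by omega)
  have hT : 1 < flatteningRank (matMulTensor K p p p) := by
    have h4 : (1 : ℝ) < (flatteningRank (matMulTensor K p p p) : ℝ) := by
      rw [hζ]; nlinarith
    exact_mod_cast h4
  have hfl := gauge₁_floor_asymptoticRank _ hq ht h hT
  have hR : Real.log (asymptoticRank (matMulTensor K p p p)) = omega K * Real.log p := by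
    rw [asymptoticRank_matMulTensor K p (by omega), Real.log_rpow hp0]
  have hZ : Real.log (flatteningRank (matMulTensor K p p p) : ℝ) = 2 * Real.log p := by
    rw [hζ, Real.log_pow]; push_cast; ring
  rw [hR, hZ, mul_div_mul_right _ _ hL.ne'] at hfl
  exact hfl

/-- **Far base**: every certificate from a power of a far format `⟨p^k,p,p⟩` (`p ≥ 2`) obeys
`(a+c) · ω(1,k,1)/(k+1) ≤ U`; the relative excess it must carry is `δ_k/(k+1)`, `δ_k = ω(1,k,1) − (k+1)` the far
defect (`E_k` of the route is `δ_k = 0`) — nearly silent for the far formats of record.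
[cite: ChristandlLeGallLysikovZuiddam2020, Thm. 3.10; AlmanDuanVassilevskaWilliamsXuXuZhou2025, §3.4] -/
theorem farBase_floor {p : ℕ} (hp : 2 ≤ p) (k : ℕ) {N t q a b c : ℕ} (hq : 2 ≤ q) (ht : 1 ≤ t)
    (h : PolyDegeneratesTo (kroneckerPow (matMulTensor K (p ^ k) (p ^ 1) (p ^ 1)) N)
      (kroneckerTensor (unitTensor K t) (matMulTensor K (q ^ a) (q ^ b) (q ^ c)))) :
    ((a + c : ℕ) : ℝ) * (omegaRect K 1 k 1 / ((k : ℝ) + 1)) ≤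
      ((N : ℝ) * (omegaRect K 1 k 1 * Real.log p) - Real.log t) / Real.log q := by
  have hfl := matMulBase_floor (K := K) hp 1 (by omega : 1 ≤ k + 1) hq ht h
  rw [omegaRect_swap₁₂ K (1 : ℝ) (k : ℝ) 1]
  push_cast at hfl ⊢
  exact hfl

end BaseFloor

end Summit.MatrixMultiplication.MatrixMultiplication.Theorems.SaturationLadderFlatFormats

end
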